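import Summits.HodgeConjecture.HodgeConjecture.Theorems.MilnorKExponentialSymbolLiftRPowerNormalisationZigZag
import Literature.AlgebraicGeometry.HodgeTheory.ComplexifiedDeRhamFamily
import Literature.NumberTheory.Transcendental.DeRhamTheoremMultiplicative
import Literature.AlgebraicGeometry.HodgeTheory.HardLefschetzNFoldHolds
import Literature.AlgebraicGeometry.HodgeTheory.LefschetzOneOneHeartOfCechIntegral
import Literature.AlgebraicGeometry.HodgeTheory.LefschetzOneOneCechIntegrality
import Literature.AlgebraicGeometry.HodgeTheory.RationalLatticeIntegral
import Literature.AlgebraicGeometry.HodgeTheory.AlgebraicClassesHodgeTypeHolds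
import Literature.AlgebraicGeometry.HodgeTheory.HodgeFiltrationModelsReductionProofs
import Literature.AlgebraicGeometry.ModuliOfSheaves.MuStability
import HarnessLib

/-!
# Stub `stub_powerNormalisation` (S2) of line `lefschetz-fold`, crux `SymbolLiftR`

Route `MilnorKExponential` of the Hodge summit, item stmt-HodgeConjecture-18702. A Hodge model `A`
of a smooth projective complex `n`-fold whose de Rham comparison is de Rham's INTEGRATION
comparison complexified and rescaled by `(2πi)^{-k/2}` in degree `k` is symbol-normalised
(`HodgeModel.IsSymbolNormalized`) in every degree `2(q+1) ≤ 2n`: the `(q+1)`-fold cup power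
`L.symbolCochain q` of the transition cocycle of a holomorphic line bundle realising an integral
Kähler class `η` (heart of Lefschetz `(1,1)` for the integration comparison) transgresses, through
the explicit staircase of the companion file `…PowerNormalisationZigZag`, to `ε_0 T^{q+1}`
(`T = -2πi θ_ch`), whose class under `A.deRham` is `± A^*(η^{q+1})` (multiplicativity of the
integration comparison, `exists_class`), rational and non-zero (`∫ ωⁿ > 0`, Voisin I Cor. 3.9).
Everything is proved.
-/

noncomputable section
open scoped Manifold ContDiff Topology

-- `Summit.HodgeConjecture.HodgeConjecture.Theorems` is the mandated namespace (single-conjunct summit: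
-- Sub = Summit), which `linter.dupNamespace` flags on every declaration; the lakefile turns the
-- linter off tree-wide (weak option), restated here so stand-alone elaboration is warning-free too.
set_option linter.dupNamespace false

namespace Summit.HodgeConjecture.HodgeConjecture.Theorems.SymbolLiftR
open Literature.AlgebraicGeometry Literature.AlgebraicGeometry.HodgeTheory
open Literature.Geometry.Kaehler Literature.NumberTheory.Transcendental

namespace PowerNormalisation

open Set Filter

/-! ### Part 5. The de Rham class of the bottom form under the rescaled integration comparison -/

section Cohomology

open Literature.AlgebraicTopology.SingularHomology (singularCohomology cupProduct)

variable {E : Type} [NormedAddCommGroup E] [NormedSpace ℂ E]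
  {M : Type} [TopologicalSpace M] [ChartedSpace E M]

/-- Real-closed complex forms are complex-closed (`cclosedSmoothForms` adds nothing). [folklore] -/
theorem cclosed_of_closed {k : ℕ} {α : MForm 𝓘(ℝ, E) M ℂ k} (h : α ∈ closedSmoothForms 𝓘(ℝ, E) M ℂ k) :
    α ∈ cclosedSmoothForms E M k :=
  (mem_cclosedSmoothForms_iff α).2 ((mem_closedSmoothForms_iff α).1 h)

/-- Complex-closed forms are real-closed. [folklore] -/
theorem closed_of_cclosed {k : ℕ} {α : MForm 𝓘(ℝ, E) M ℂ k} (h : α ∈ cclosedSmoothForms E M k) :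
    α ∈ closedSmoothForms 𝓘(ℝ, E) M ℂ k :=
  (mem_closedSmoothForms_iff α).2 ((mem_cclosedSmoothForms_iff α).1 h)

/-- Powers of a closed smooth complex `2`-form are closed smooth complex forms. [folklore] -/
theorem twoFormPow_cmem [WedgeFacts 𝓘(ℝ, E) M ℂ] {T : MForm 𝓘(ℝ, E) M ℂ 2}
    (hT : T ∈ cclosedSmoothForms E M 2) (p : ℕ) :
    MForm.twoFormPow 𝓘(ℝ, E) M T p ∈ cclosedSmoothForms E M (2 * p) :=
  cclosed_of_closed (twoFormPow_mem_closedSmoothForms (closed_of_cclosed hT) p)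

/-- A real multiple of a complex form is the corresponding complex multiple. [folklore] -/
theorem coe_real_smul {k : ℕ} (r : ℝ) (F : MForm 𝓘(ℝ, E) M ℂ k) : ((r : ℂ) • F) = r • F := by
  funext x
  ext v
  change (r : ℂ) * F x v = r • F x v
  rw [Complex.real_smul]

/-- The scalar of the final comparison: `((2πi)^{q+1})⁻¹ (-1)^N (-2πi)^{q+1} = (-1)^{N+q+1}`. [folklore] -/
theorem scalar_identity (N q : ℕ) :
    ((2 * (Real.pi : ℂ) * Complex.I) ^ (q + 1))⁻¹ * (-1 : ℂ) ^ N * (-(2 * (Real.pi : ℂ) * Complex.I)) ^ (q + 1) =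
      (-1 : ℂ) ^ (N + (q + 1)) := by
  have hne : (2 * (Real.pi : ℂ) * Complex.I) ^ (q + 1) ≠ 0 := pow_ne_zero _ Complex.two_pi_I_ne_zero
  have h1 : ((2 * (Real.pi : ℂ) * Complex.I) ^ (q + 1))⁻¹ * (2 * (Real.pi : ℂ) * Complex.I) ^ (q + 1) = 1 :=
    inv_mul_cancel₀ hne
  calc ((2 * (Real.pi : ℂ) * Complex.I) ^ (q + 1))⁻¹ * (-1 : ℂ) ^ N * (-(2 * (Real.pi : ℂ) * Complex.I)) ^ (q + 1)
      = (-1 : ℂ) ^ N * (-1) ^ (q + 1) *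
          (((2 * (Real.pi : ℂ) * Complex.I) ^ (q + 1))⁻¹ * (2 * (Real.pi : ℂ) * Complex.I) ^ (q + 1)) := by
        rw [neg_pow (2 * (Real.pi : ℂ) * Complex.I)]
        ring
    _ = (-1 : ℂ) ^ (N + (q + 1)) := by rw [h1, mul_one, ← pow_add]

variable [IsManifold 𝓘(ℝ, E) ∞ M] [T2Space M] [SigmaCompactSpace M]
  [WedgeFacts 𝓘(ℝ, E) M ℝ] [WedgeFacts 𝓘(ℝ, E) M ℂ]

/-- **`(e ⊗ ℂ)[(α ∧ β).castDeg] = (e ⊗ ℂ)[α] ∪ (e ⊗ ℂ)[β]`** with a free target degree `k + l = m`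
(the tree's `complexifyFun_mk_wedge`, Warner Thm. 5.45, recast). [cite: WarnerGTM94, Thm. 5.45] -/
theorem complexifyFun_mk_wedge_castDeg {e : DeRhamIsoFamily 𝓘(ℝ, E)} (he : e.IsMultiplicative)
    {k l m : ℕ} (h : k + l = m) (α : cclosedSmoothForms E M k) (β : cclosedSmoothForms E M l)
    (hmem : ((α : MForm 𝓘(ℝ, E) M ℂ k).wedge (β : MForm 𝓘(ℝ, E) M ℂ l)).castDeg h ∈ cclosedSmoothForms E M m) :
    complexifyFun e m (complexDeRhamCohomology.mk E M m
        ⟨((α : MForm 𝓘(ℝ, E) M ℂ k).wedge (β : MForm 𝓘(ℝ, E) M ℂ l)).castDeg h, hmem⟩) =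
      cupProduct h (complexifyFun e k (complexDeRhamCohomology.mk E M k α))
        (complexifyFun e l (complexDeRhamCohomology.mk E M l β)) := by
  subst h
  rw [← complexifyFun_mk_wedge he α β]
  rfl

/-- **`(e ⊗ ℂ)[θᵖ] = ((e ⊗ ℂ)[θ])ᵖ`** for a closed complex `2`-form `θ`, `p ≥ 1`, and a multiplicative
real de Rham family `e` (iterate `complexifyFun_mk_wedge`; `θᵖ⁺¹ = θᵖ ∧ θ`, `xᵖ⁺¹ = xᵖ ∪ x`).
[cite: WarnerGTM94, Thm. 5.45] [cite: HatcherAT2002, §3.2] -/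
theorem complexifyFun_mk_twoFormPow {e : DeRhamIsoFamily 𝓘(ℝ, E)} (he : e.IsMultiplicative)
    {T : MForm 𝓘(ℝ, E) M ℂ 2} (hT : T ∈ cclosedSmoothForms E M 2) {p : ℕ} (hp : 1 ≤ p) :
    complexifyFun e (2 * p) (complexDeRhamCohomology.mk E M (2 * p)
        ⟨MForm.twoFormPow 𝓘(ℝ, E) M T p, twoFormPow_cmem hT p⟩) =
      cupPowTwo (complexifyFun e 2 (complexDeRhamCohomology.mk E M 2 ⟨T, hT⟩)) p := by
  induction p, hp using Nat.le_induction with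
  | base =>
    rw [cupPowTwo_one]
    have h1 : MForm.twoFormPow 𝓘(ℝ, E) M T 1 = T := by
      rw [MForm.twoFormPow_succ, MForm.twoFormPow_zero, MForm.castDeg_wedge, MForm.castDeg_castDeg]
      have h : (MForm.const 𝓘(ℝ, E) M (1 : ℂ)).wedge T = T.castDeg (Nat.zero_add 2).symm := ofFun_one_wedge T
      rw [h, MForm.castDeg_castDeg]
      exact MForm.castDeg_eq_self _ _
    have h2 : (⟨MForm.twoFormPow 𝓘(ℝ, E) M T 1, twoFormPow_cmem hT 1⟩ : cclosedSmoothForms E M (2 * 1)) = ⟨T, hT⟩ :=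
      Subtype.ext h1
    rw [h2]
  | succ p hp ih =>
    rw [cupPowTwo_succ, ← ih]
    exact complexifyFun_mk_wedge_castDeg he (two_mul_add_two p) ⟨_, twoFormPow_cmem hT p⟩ ⟨T, hT⟩
      (twoFormPow_cmem hT (p + 1))

/-- **The class of `ε (-2πi θ)^{q+1}` under the rescaled integration comparison of a Hodge model
`A`**: if `A.deRham = ((2πi)^{k/2})⁻¹ • (integration ⊗ ℂ)` on `A.carrier` and the closed `2`-form
`θ` represents the pull-back of a rational class `η` under `integration ⊗ ℂ`, then for
`T = -2πi θ` the class `A.deRham [(-1)^N T^{q+1}]` is `A^*(c₀)` with `c₀ = (-1)^{N+q+1} η^{q+1}`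
rational, and non-zero as soon as `η^{q+1} ≠ 0` (multiplicativity of the integration comparison,
`integrationDeRhamIsoFamily_isMultiplicative`; pull-back is multiplicative, `map_cupPowTwo`). Stated
for any degree `d = 2(q+1)`. [cite: WarnerGTM94, Thm. 5.45] [cite: VoisinHodgeI2002, Thm. 7.10 (proof)] -/
theorem exists_class {n : ℕ} {X : Motives.SchemeOver ℂ} (A : HodgeModel n X)
    (hA : ∀ (k : ℕ) (y : complexDeRhamCohomology A.model A.carrier k), A.deRham A.carrier k y =
      ((2 * (Real.pi : ℂ) * Complex.I) ^ (k / 2))⁻¹ • (integrationDeRhamIsoFamily A.model).complexify A.carrier k y)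
    [WedgeFacts 𝓘(ℝ, A.model) A.carrier ℝ] [WedgeFacts 𝓘(ℝ, A.model) A.carrier ℂ]
    {θ : MForm 𝓘(ℝ, A.model) A.carrier ℂ 2} (hθc : θ ∈ cclosedSmoothForms A.model A.carrier 2)
    {η : complexBetti X 2} (hη : IsRationalClass η)
    (hηθ : A.pullback 2 η = (integrationDeRhamIsoFamily A.model).complexify A.carrier 2
      (complexDeRhamCohomology.mk A.model A.carrier 2 ⟨θ, hθc⟩))
    (q N : ℕ) (hpow : cupPowTwo η (q + 1) ≠ 0) {d : ℕ} (hd : 2 * (q + 1) = d)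
    (hmem : (((-1 : ℝ) ^ N • MForm.twoFormPow 𝓘(ℝ, A.model) A.carrier
      ((-(2 * (Real.pi : ℂ) * Complex.I)) • θ) (q + 1)).castDeg hd) ∈ cclosedSmoothForms A.model A.carrier d) :
    ∃ c₀ : complexBetti X d, IsRationalClass c₀ ∧ c₀ ≠ 0 ∧
      A.deRham A.carrier d (complexDeRhamCohomology.mk A.model A.carrier d ⟨_, hmem⟩) = A.pullback d c₀ := by
  subst hd
  have hem : (integrationDeRhamIsoFamily A.model).IsMultiplicative := integrationDeRhamIsoFamily_isMultiplicative
  have hT : (-(2 * (Real.pi : ℂ) * Complex.I)) • θ ∈ cclosedSmoothForms A.model A.carrier 2 :=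
    Submodule.smul_mem _ _ hθc
  -- `(e₀ ⊗ ℂ)[T] = -2πi • A^* η`
  have h1 : complexifyFun (integrationDeRhamIsoFamily A.model) 2
      (complexDeRhamCohomology.mk A.model A.carrier 2 ⟨(-(2 * (Real.pi : ℂ) * Complex.I)) • θ, hT⟩) =
        (-(2 * (Real.pi : ℂ) * Complex.I)) • A.pullback 2 η := by
    have h : (⟨(-(2 * (Real.pi : ℂ) * Complex.I)) • θ, hT⟩ : cclosedSmoothForms A.model A.carrier 2) =
        (-(2 * (Real.pi : ℂ) * Complex.I)) • ⟨θ, hθc⟩ := rfl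
    rw [h, map_smul, complexifyFun_smul, hηθ, complexify_apply]
  -- `(e₀ ⊗ ℂ)[T^{q+1}] = (-2πi)^{q+1} • A^*(η^{q+1})`
  have h2 : complexifyFun (integrationDeRhamIsoFamily A.model) (2 * (q + 1))
      (complexDeRhamCohomology.mk A.model A.carrier (2 * (q + 1))
        ⟨MForm.twoFormPow 𝓘(ℝ, A.model) A.carrier ((-(2 * (Real.pi : ℂ) * Complex.I)) • θ) (q + 1),
          twoFormPow_cmem hT (q + 1)⟩) =
        (-(2 * (Real.pi : ℂ) * Complex.I)) ^ (q + 1) • A.pullback (2 * (q + 1)) (cupPowTwo η (q + 1)) := by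
    rw [complexifyFun_mk_twoFormPow hem hT (Nat.le_add_left 1 q), h1, ModuliOfSheaves.cupPowTwo_smul, ← map_cupPowTwo]
  -- the bottom form as a complex multiple
  have h3 : (⟨((-1 : ℝ) ^ N • MForm.twoFormPow 𝓘(ℝ, A.model) A.carrier
      ((-(2 * (Real.pi : ℂ) * Complex.I)) • θ) (q + 1)).castDeg rfl, hmem⟩ :
        cclosedSmoothForms A.model A.carrier (2 * (q + 1))) =
      ((-1 : ℂ) ^ N) • ⟨MForm.twoFormPow 𝓘(ℝ, A.model) A.carrier ((-(2 * (Real.pi : ℂ) * Complex.I)) • θ) (q + 1),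
        twoFormPow_cmem hT (q + 1)⟩ := by
    apply Subtype.ext
    change (-1 : ℝ) ^ N • MForm.twoFormPow 𝓘(ℝ, A.model) A.carrier ((-(2 * (Real.pi : ℂ) * Complex.I)) • θ) (q + 1) =
      ((-1 : ℂ) ^ N) • MForm.twoFormPow 𝓘(ℝ, A.model) A.carrier ((-(2 * (Real.pi : ℂ) * Complex.I)) • θ) (q + 1)
    rw [← coe_real_smul]
    push_cast
    rfl
  refine ⟨((-1 : ℂ) ^ (N + (q + 1))) • cupPowTwo η (q + 1), ?_, ?_, ?_⟩
  · have h := (hη.cupPowTwo (q + 1)).smul ((-1 : ℚ) ^ (N + (q + 1)))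
    push_cast at h
    exact h
  · exact smul_ne_zero (pow_ne_zero _ (neg_ne_zero.2 one_ne_zero)) hpow
  · rw [hA, Nat.mul_div_cancel_left _ two_pos, complexify_apply, h3, map_smul, complexifyFun_smul, h2,
      smul_smul, smul_smul, map_smul, scalar_identity]

end Cohomology

end PowerNormalisation

/-! ### Part 6. The stub -/

open PowerNormalisation in
/-- **S2 (normalisation in every degree by cup powers).** A Hodge model `A` of a smooth projective
complex `n`-fold whose de Rham comparison, read on its own carrier, is de Rham's integration
comparison complexified and rescaled by `(2πi)^{-k/2}` in degree `k`, is symbol-normalised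
(`HodgeModel.IsSymbolNormalized`) in every degree `2(q+1) ≤ 2n`. Proof: an integral Kähler class
`η` (an integral positive multiple of the hyperplane-type class of a projective embedding; `η^{q+1} ≠ 0`
for `q + 1 ≤ n`, Voisin I Cor. 3.9) is, by the Chern–Weil heart of Lefschetz `(1,1)` for the
integration comparison (`exists_isChernForm_of_cechIntegral`, `CechCocycleIntegral_holds`), the
class of the Chern form `θ` of a Hermitian holomorphic line bundle `L` on a finite chart-convex
cover; the symbol forms of the cup powers `L.symbolCochain q` transgress through the explicit
staircase `Z_{a,2q+1-a} = ε_a (P_a ∪ α) ∧ T^{q-a}` (`α_i = ∂ log h_i`, `T = dα_i = -2πi θ`) to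
`ε_0 T^{q+1}` (`isTransgression_symbolCochain`), whose class under `A.deRham` is `± A^*(η^{q+1})`
(multiplicativity of integration, `exists_class`), rational and non-zero.
[cite: VoisinHodgeI2002, Thm. 7.10 (proof) and Cor. 3.9] [cite: BottTu1982Forms, §8 Prop. 8.8] -/
theorem stub_powerNormalisation : ∀ ⦃n : ℕ⦄ ⦃X : Motives.SchemeOver ℂ⦄, Motives.IsSmoothProjective n X → ∀ A : HodgeModel n X, (∀ (k : ℕ) (y : complexDeRhamCohomology A.model A.carrier k), A.deRham A.carrier k y = ((2 * (Real.pi : ℂ) * Complex.I) ^ (k / 2))⁻¹ • (integrationDeRhamIsoFamily A.model).complexify A.carrier k y) → ∀ q : ℕ, q + 1 ≤ n → A.IsSymbolNormalized q := by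
  intro n X hX A hA q hq
  -- instances on the carrier
  haveI : CompactSpace A.carrier := by
    haveI := compactSpace_complexPoints_of_isSmoothProjective hX
    exact A.isAnalytification.homeomorph.symm.compactSpace
  haveI : WedgeFacts 𝓘(ℝ, A.model) A.carrier ℝ :=
    wedgeFacts_of_assoc 𝓘(ℝ, A.model) A.carrier ℝ (ContinuousAlternatingMap.WedgeAssoc_holds ℝ A.model ℝ)
  haveI : WedgeFacts 𝓘(ℝ, A.model) A.carrier ℂ :=
    wedgeFacts_of_assoc 𝓘(ℝ, A.model) A.carrier ℂ (ContinuousAlternatingMap.WedgeAssoc_holds ℝ A.model ℂ)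
  -- (1) an integral Kähler class `η` with `η^{q+1} ≠ 0`
  obtain ⟨N₀, ι, hι⟩ := hX.isProjectiveOver
  obtain ⟨e, he, hem, -⟩ := exists_deRhamIsoFamily_holds A.model
  have hθFS := A.fubiniStudyPullbackForm_mem_closedSmoothForms ι
  obtain ⟨H, hH⟩ := A.pullback_surjective 2 (ofRealClass A.carrier 2 (e A.carrier 2
    (deRhamCohomology.mk ⟨Motives.AnalytificationKaehler.fubiniStudyPullbackForm A.model ι A.toComplexPoints, hθFS⟩)))
  obtain ⟨r, hr, hrat⟩ := exists_pos_smul_isRationalClass_of_pullback_eq_fubiniStudy hX A ι e he hθFS hH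
  have hK : A.IsKaehlerClassVia e ((r : ℂ) • H) :=
    (A.isKaehlerClassVia_of_pullback_eq_fubiniStudyPullbackForm e hX ι hθFS hH).smul_of_pos hr
  obtain ⟨N, hN, hint⟩ := hrat.exists_nsmul_isIntegralClass hX
  have hKη : A.IsKaehlerClassVia e ((N : ℂ) • ((r : ℂ) • H)) := by
    have h := hK.smul_of_pos (Nat.cast_pos.2 hN)
    rwa [Complex.ofReal_natCast] at h
  have hηrat : IsRationalClass ((N : ℂ) • ((r : ℂ) • H)) := hint.isRationalClass
  have hpow : cupPowTwo ((N : ℂ) • ((r : ℂ) • H)) (q + 1) ≠ 0 :=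
    hKη.cupPowTwo_ne_zero hX hem (Nat.le_add_left 1 q) hq
  have h11 : IsOfHodgeType n X 2 1 1 ((N : ℂ) • ((r : ℂ) • H)) := hKη.isOfHodgeType_one_one he
  -- (2) its pull-back is integral and lies in `e₀(H^{1,1})` for the integration comparison `e₀`
  have hβi : IsIntegralClass (A.pullback 2 ((N : ℂ) • ((r : ℂ) • H))) := hint.map _
  have hβ11 : A.pullback 2 ((N : ℂ) • ((r : ℂ) • H)) ∈ (hodgePQ A.model A.carrier 2 1 1).map
      ((integrationDeRhamIsoFamily A.model).complexify A.carrier 2).toLinearMap := by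
    have hA11 : A.pullback 2 ((N : ℂ) • ((r : ℂ) • H)) ∈ A.hodgePQ 2 1 1 :=
      (hodgePQ_independent_of_hodgeModel_holds.isOfHodgeType_iff hX A).1 h11
    obtain ⟨c, hc, hcβ⟩ := Submodule.mem_map.1 hA11
    refine Submodule.mem_map.2 ⟨((2 * (Real.pi : ℂ) * Complex.I) ^ (2 / 2))⁻¹ • c, Submodule.smul_mem _ _ hc, ?_⟩
    change (integrationDeRhamIsoFamily A.model).complexify A.carrier 2 (_ • c) = _
    rw [map_smul, ← hA 2 c]
    exact hcβ
  -- (3) the heart of Lefschetz `(1,1)`: a Hermitian holomorphic line bundle with Chern form `θ`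
  obtain ⟨θ, hθc, hθt, hθr, hβθ⟩ := exists_real_closed_oneOne_rep _ hβi hβ11
  have hθs : IsSmoothForm θ := ((mem_cclosedSmoothForms_iff θ).1 hθc).1
  have hθcl : IsClosedForm θ := ((mem_cclosedSmoothForms_iff θ).1 hθc).2
  obtain ⟨s, ⟨𝒰⟩⟩ := exists_chartConvexCover (E := A.model) (M := A.carrier)
  have hint' : IsIntegralClass ((integrationDeRhamIsoFamily A.model).complexify A.carrier 2
      (complexDeRhamCohomology.mk A.model A.carrier 2 ⟨θ, hθc⟩)) := hβθ ▸ hβi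
  obtain ⟨L, hmet, -, hChern⟩ := exists_isChernForm_of_cechIntegral 𝒰 hθs hθcl hθt hθr
    (CechCocycleIntegral_holds A.model A.carrier (↥s) 𝒰 θ hθc hint')
  -- (4) the zig-zag of the cup powers (Chern connection `α_i = ∂ log h_i`, `T = -2πi θ`) and its class
  have hd : 2 * (q + 1) = 2 * q + 1 + 1 := by ring
  have hT := isTransgression_symbolCochain (L := L) (α := fun i ↦ dPrime A.model (hmet.logWeight i))
    (T := (-(2 * (Real.pi : ℂ) * Complex.I)) • θ) (fun i x hx ↦ chern_smoothAt hmet i x hx)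
    (fun i x hx ↦ chern_mextDeriv hmet hChern i x hx) (fun a b x hx ↦ chern_dlog hmet a b x hx)
    (chern_closed hθc) q hd
  have hmem : (((-1 : ℝ) ^ (q + 1 + q * (q + 1) / 2 + 0 * (0 + 1) / 2) • MForm.twoFormPow 𝓘(ℝ, A.model) A.carrier
      ((-(2 * (Real.pi : ℂ) * Complex.I)) • θ) (q + 1)).castDeg hd) ∈ cclosedSmoothForms A.model A.carrier (2 * q + 1 + 1) :=
    cclosed_of_closed (hT.mem_closedSmoothForms L.exists_mem_baseSet)
  obtain ⟨c₀, hc₀, hne, hdeR⟩ := exists_class A hA hθc hηrat hβθ q _ hpow hd hmem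
  exact ⟨↥s, inferInstance, L, ⟨_, hmem⟩, c₀, hT, hc₀, hne, hdeR⟩

end Summit.HodgeConjecture.HodgeConjecture.Theorems.SymbolLiftR

end
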